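import Summits.CriticalPhenomena.PercolationContinuityZ3.Theorems.PercNearOneGluingNoHeavyQuantRootDecFloorSplit
import Mathlib.Analysis.MeanInequalities
import Mathlib.Analysis.SpecialFunctions.Pow.Real
import HarnessLib

/-!
# QUANT lane R8 — "at most one open", part B: the analytic bound for `n ≥ 4` pairwise-completing blobs

builds on p205010 (kernel theorem, internal audit signed; external expert review pending)

Support file (`--supports stmt-CriticalPhenomena-4575`), QUANT lane typer seat prim-quant-stmt (gen 20).  Theorems only (real analysis, no
blob vocabulary): the ingredients of the bound `P(at most one of n open) ≤ 1 − x` for `n ≥ 4` blobs whose credit rates sum to `≥ 2`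
(part C, `…QuantAtMostOneBound`), in the closure coordinates `y = 1 − x ∈ (0, 1/2]`, `q_k ≤ y·(2 − y − c_k)`.

THE CHAIN (for the record; `n = m + 2`, `T₀ = 2 − y`, `β = (n−1)y/n`, credits rescaled to `Σ c = 2`):
`AMO ≤ y^{n−1} Σ_k (∏_{l≠k} t_l)(1 − β t_k)` (`t = T₀ − c`) `≤ y^{n−1} Σ_k (T₀ − (2 − c_k)/(n−1))^{n−1}(1 − β(T₀ − c_k))` (AM–GM,
`Literature.….Gurvits.finset_prod_le_arith_mean_pow`) `≤ y^{n−1}[(n−2)·F(0) + 2·F(1)]` (chord inequalities `pow_affine_le_chord`, `chord_mul_affine`; `Σ c = 2`)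
`= y·B'_n(y) ≤ y` (`boundPrime_le_one`).

* `Quant.IndepBlob.pow_affine_le_chord` — `(a + bz)^m ≤ (1 − z)a^m + z(a + b)^m` on `[0,1]` (`a, b ≥ 0`).
* `Quant.IndepBlob.chord_mul_affine` — the chord inequality survives multiplication by a nondecreasing nonnegative affine factor.
* `Quant.IndepBlob.pow_mul_pow_le_endpoint` — `y^a (A − y)^b ≤ y₁^a (A − y₁)^b` for `0 ≤ y ≤ y₁` when `b·y₁ ≤ a·(A − y₁)` (via `1 + u ≤ e^u`).
* `Quant.IndepBlob.boundFour_le_one` (`n = 4`: a degree-7 polynomial with positive Bernstein coefficients on `[0, 1/2]`),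
  `crude_tail_le_one`, `bHalf_le_one` (the values at `y = 1/2`, `n = 5, …, 13` by evaluation — `b_5 = 1009/1024` —, `n ≥ 14` crude),
  **`boundPrime_le_one`**: `B'_n(y) ≤ 1` for all `n ≥ 4`, `0 ≤ y ≤ 1/2`.
Numerics (kit j130470, exact rationals): `max_y B'_4 = 0.7717`, `b_5 = 1009/1024`, `b_n` decreasing.  [this work]
-/

namespace Summit.CriticalPhenomena.PercolationContinuityZ3.Theorems

namespace Quant

namespace IndepBlob

open Finset

/-! ### 1. Analytic lemmas: two chord inequalities, an endpoint bound (AM–GM with a natural exponent is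
`Literature.Combinatorics.StablePolynomials.Gurvits.finset_prod_le_arith_mean_pow`) -/

/-- **Chord inequality for a power of an affine function**: `a, b ≥ 0`, `z ∈ [0,1]` ⟹ `(a + b z)^m ≤ (1 − z)·a^m + z·(a + b)^m`. [folklore] -/
theorem pow_affine_le_chord (a b : ℝ) (ha : 0 ≤ a) (hb : 0 ≤ b) (z : ℝ) (hz0 : 0 ≤ z) (hz1 : z ≤ 1) (m : ℕ) :
    (a + b * z) ^ m ≤ (1 - z) * a ^ m + z * (a + b) ^ m := by
  induction m with
  | zero => simp only [pow_zero]; linarith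
  | succ m ih =>
    have h0 : 0 ≤ a + b * z := by positivity
    have hpow : a ^ m ≤ (a + b) ^ m := pow_le_pow_left₀ ha (le_add_of_nonneg_right hb) m
    have ham : 0 ≤ a ^ m := pow_nonneg ha m
    rw [pow_succ, pow_succ, pow_succ]
    have h1 : (a + b * z) ^ m * (a + b * z) ≤ ((1 - z) * a ^ m + z * (a + b) ^ m) * (a + b * z) :=
      mul_le_mul_of_nonneg_right ih h0
    nlinarith [mul_nonneg (mul_nonneg (mul_nonneg hz0 (sub_nonneg.2 hz1)) hb) (sub_nonneg.2 hpow)]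

/-- **Chord inequality, product with a nondecreasing nonnegative affine factor**: from `fz ≤ (1 − z) f₀ + z f₁`, `f₀ ≤ f₁`, `α, β ≥ 0`,
`z ∈ [0,1]`: `fz·(α + β z) ≤ (1 − z)·(f₀ α) + z·(f₁ (α + β))`. [folklore] -/
theorem chord_mul_affine (f₀ f₁ fz α β z : ℝ) (hz0 : 0 ≤ z) (hz1 : z ≤ 1) (hα : 0 ≤ α) (hβ : 0 ≤ β) (hf : f₀ ≤ f₁)
    (hchord : fz ≤ (1 - z) * f₀ + z * f₁) : fz * (α + β * z) ≤ (1 - z) * (f₀ * α) + z * (f₁ * (α + β)) := by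
  have hh : 0 ≤ α + β * z := by positivity
  nlinarith [mul_le_mul_of_nonneg_right hchord hh,
    mul_nonneg (mul_nonneg (mul_nonneg hz0 hβ) (sub_nonneg.2 hz1)) (sub_nonneg.2 hf)]

/-- **Endpoint bound**: `0 ≤ y ≤ y₁ < A`, `0 < y₁`, and `b·y₁ ≤ a·(A − y₁)` ⟹ `y^a (A − y)^b ≤ y₁^a (A − y₁)^b` (with `u = y/y₁ = 1 − v`:
`(1 − v)^a (1 + εv)^b ≤ e^{−av} e^{bεv} ≤ 1`, `ε = y₁/(A − y₁)`). [folklore] -/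
theorem pow_mul_pow_le_endpoint (a b : ℕ) (A y y₁ : ℝ) (hy0 : 0 ≤ y) (hy : y ≤ y₁) (hy₁ : 0 < y₁) (hA : y₁ < A)
    (hcond : (b : ℝ) * y₁ ≤ a * (A - y₁)) : y ^ a * (A - y) ^ b ≤ y₁ ^ a * (A - y₁) ^ b := by
  have hAy₁ : 0 < A - y₁ := by linarith
  set v : ℝ := 1 - y / y₁ with hv
  have hv0 : 0 ≤ v := by rw [hv, sub_nonneg, div_le_one hy₁]; exact hy
  -- `y = y₁ (1 − v)`, `A − y = (A − y₁)(1 + ε v)`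
  have e1 : y = y₁ * (1 - v) := by rw [hv]; field_simp; ring
  have e2 : A - y = (A - y₁) * (1 + y₁ / (A - y₁) * v) := by rw [hv]; field_simp; ring
  have h1v : 0 ≤ 1 - v := by rw [hv]; have := div_nonneg hy0 hy₁.le; linarith
  have h1e : 0 ≤ 1 + y₁ / (A - y₁) * v := by positivity
  -- the exponential comparison
  have hu : (1 - v) ^ a ≤ Real.exp (-v) ^ a :=
    pow_le_pow_left₀ h1v (by linarith [Real.add_one_le_exp (-v)]) a
  have hw : (1 + y₁ / (A - y₁) * v) ^ b ≤ Real.exp (y₁ / (A - y₁) * v) ^ b :=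
    pow_le_pow_left₀ h1e (by linarith [Real.add_one_le_exp (y₁ / (A - y₁) * v)]) b
  have hexp : Real.exp (-v) ^ a * Real.exp (y₁ / (A - y₁) * v) ^ b ≤ 1 := by
    rw [← Real.exp_nat_mul, ← Real.exp_nat_mul, ← Real.exp_add]
    apply Real.exp_le_one_iff.2
    have hε : (b : ℝ) * (y₁ / (A - y₁)) ≤ a := by
      rw [← mul_div_assoc, div_le_iff₀ hAy₁]; exact hcond
    nlinarith [mul_nonneg hv0 (sub_nonneg.2 hε)]
  have key : (1 - v) ^ a * (1 + y₁ / (A - y₁) * v) ^ b ≤ 1 :=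
    (mul_le_mul hu hw (pow_nonneg h1e b) (pow_nonneg (Real.exp_pos _).le a)).trans hexp
  rw [e2, e1, mul_pow, mul_pow]
  have hP : 0 ≤ y₁ ^ a * (A - y₁) ^ b := mul_nonneg (pow_nonneg hy₁.le a) (pow_nonneg hAy₁.le b)
  calc y₁ ^ a * (1 - v) ^ a * ((A - y₁) ^ b * (1 + y₁ / (A - y₁) * v) ^ b)
      = (y₁ ^ a * (A - y₁) ^ b) * ((1 - v) ^ a * (1 + y₁ / (A - y₁) * v) ^ b) := by ring
    _ ≤ (y₁ ^ a * (A - y₁) ^ b) * 1 := mul_le_mul_of_nonneg_left key hP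
    _ = y₁ ^ a * (A - y₁) ^ b := mul_one _

/-! ### 2. The numeric bound `B'_n(y) ≤ 1` (`n = m + 2 ≥ 4`, `0 ≤ y ≤ 1/2`) -/

/-- `n = 4`: `1 − B'_4(y) = 1 − 14y² + (745/18)y³ − 57y⁴ + 44y⁵ − 18y⁶ + 3y⁷ ≥ 0` on `[0, 1/2]` (all Bernstein coefficients on `[0, 1/2]`
positive; `linarith` over the products `y^k (1/2 − y)^{7−k}`). [this work] -/
theorem boundFour_le_one (y : ℝ) (hy0 : 0 ≤ y) (hy : y ≤ 1 / 2) :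
    y ^ 2 * (2 * (2 - y - 2 / 3) ^ 3 * (1 - 3 / 4 * y * (2 - y)) + 2 * (2 - y - 1 / 3) ^ 3 * (1 - 3 / 4 * y * (1 - y))) ≤ 1 := by
  have h : 0 ≤ 1 / 2 - y := by linarith
  nlinarith [mul_nonneg (pow_nonneg hy0 7) (pow_nonneg h 0), mul_nonneg (pow_nonneg hy0 6) (pow_nonneg h 1),
    mul_nonneg (pow_nonneg hy0 5) (pow_nonneg h 2), mul_nonneg (pow_nonneg hy0 4) (pow_nonneg h 3),
    mul_nonneg (pow_nonneg hy0 3) (pow_nonneg h 4), mul_nonneg (pow_nonneg hy0 2) (pow_nonneg h 5),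
    mul_nonneg (pow_nonneg hy0 1) (pow_nonneg h 6), mul_nonneg (pow_nonneg hy0 0) (pow_nonneg h 7)]

/-- The crude tail: for `m ≥ 12`, `(1/2)^m · (m + 2) · (3/2)^{m+1} ≤ 1`. [this work] -/
theorem crude_tail_le_one (m : ℕ) (hm : 12 ≤ m) : (1 / 2 : ℝ) ^ m * (((m : ℝ) + 2) * (3 / 2) ^ (m + 1)) ≤ 1 := by
  induction m, hm using Nat.le_induction with
  | base => norm_num
  | succ m hm ih =>
    have hm' : (12 : ℝ) ≤ m := by exact_mod_cast hm
    have e : (1 / 2 : ℝ) ^ (m + 1) * ((((m + 1 : ℕ) : ℝ) + 2) * (3 / 2) ^ (m + 1 + 1)) =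
        ((1 / 2 : ℝ) ^ m * (((m : ℝ) + 2) * (3 / 2) ^ (m + 1))) * (3 / 4 * (((m : ℝ) + 3) / ((m : ℝ) + 2))) := by
      push_cast
      field_simp
      ring
    rw [e]
    have hr : 3 / 4 * (((m : ℝ) + 3) / ((m : ℝ) + 2)) ≤ 1 := by
      rw [← mul_div_assoc, div_le_one (by positivity)]; linarith
    have hpos : 0 ≤ (1 / 2 : ℝ) ^ m * (((m : ℝ) + 2) * (3 / 2) ^ (m + 1)) := by positivity
    calc _ ≤ 1 * (3 / 4 * (((m : ℝ) + 3) / ((m : ℝ) + 2))) := mul_le_mul_of_nonneg_right ih (by positivity)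
      _ ≤ 1 := by rw [one_mul]; exact hr

/-- The value at `y = 1/2` for `n = m + 2 ≥ 5`: `b_n = (1/2)^m [m (3/2 − 2/(m+1))^{m+1} + 2 (3/2 − 1/(m+1))^{m+1}] ≤ 1`
(`n = 5, …, 13` by evaluation — `b_5 = 1009/1024` is the largest —, `n ≥ 14` by the crude tail). [this work] -/
theorem bHalf_le_one (m : ℕ) (hm : 3 ≤ m) :
    (1 / 2 : ℝ) ^ m * ((m : ℝ) * (3 / 2 - 2 / ((m : ℝ) + 1)) ^ (m + 1) + 2 * (3 / 2 - 1 / ((m : ℝ) + 1)) ^ (m + 1)) ≤ 1 := by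
  by_cases h12 : 12 ≤ m
  · have hm0 : (0 : ℝ) ≤ m := Nat.cast_nonneg m
    have hm12 : (12 : ℝ) ≤ m := by exact_mod_cast h12
    have h1 : (3 / 2 - 2 / ((m : ℝ) + 1)) ^ (m + 1) ≤ (3 / 2 : ℝ) ^ (m + 1) :=
      pow_le_pow_left₀ (by rw [sub_nonneg, div_le_iff₀ (by positivity)]; linarith) (by
        have : 0 ≤ 2 / ((m : ℝ) + 1) := by positivity
        linarith) _
    have h2 : (3 / 2 - 1 / ((m : ℝ) + 1)) ^ (m + 1) ≤ (3 / 2 : ℝ) ^ (m + 1) :=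
      pow_le_pow_left₀ (by rw [sub_nonneg, div_le_iff₀ (by positivity)]; linarith) (by
        have : 0 ≤ 1 / ((m : ℝ) + 1) := by positivity
        linarith) _
    calc _ ≤ (1 / 2 : ℝ) ^ m * ((m : ℝ) * (3 / 2) ^ (m + 1) + 2 * (3 / 2) ^ (m + 1)) := by
          refine mul_le_mul_of_nonneg_left ?_ (by positivity)
          nlinarith [mul_le_mul_of_nonneg_left h1 hm0]
      _ = (1 / 2 : ℝ) ^ m * (((m : ℝ) + 2) * (3 / 2) ^ (m + 1)) := by ring
      _ ≤ 1 := crude_tail_le_one m h12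
  · interval_cases m <;> norm_num

/-- **The numeric bound `B'_n(y) ≤ 1`** for `n = m + 2 ≥ 4` and `0 ≤ y ≤ 1/2`:
`y^m [m (2 − y − 2/(m+1))^{m+1} (1 − ((m+1)/(m+2)) y (2 − y)) + 2 (2 − y − 1/(m+1))^{m+1} (1 − ((m+1)/(m+2)) y (1 − y))] ≤ 1`.
(`m = 2`: `boundFour_le_one`; `m ≥ 3`: drop the last factors, move `y` to `1/2` by `pow_mul_pow_le_endpoint`, then `bHalf_le_one`.) [this work] -/
theorem boundPrime_le_one (m : ℕ) (hm : 2 ≤ m) (y : ℝ) (hy0 : 0 ≤ y) (hy : y ≤ 1 / 2) :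
    y ^ m * ((m : ℝ) * (2 - y - 2 / ((m : ℝ) + 1)) ^ (m + 1) * (1 - ((m : ℝ) + 1) / ((m : ℝ) + 2) * y * (2 - y)) +
      2 * (2 - y - 1 / ((m : ℝ) + 1)) ^ (m + 1) * (1 - ((m : ℝ) + 1) / ((m : ℝ) + 2) * y * (1 - y))) ≤ 1 := by
  rcases Nat.lt_or_ge m 3 with h3 | h3
  · have hm2 : m = 2 := by omega
    subst hm2
    have e : ((2 : ℕ) : ℝ) = 2 := by norm_num
    rw [e]
    have := boundFour_le_one y hy0 hy
    norm_num at this ⊢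
    linarith
  have hm0 : (3 : ℝ) ≤ m := by exact_mod_cast h3
  -- the two factors are in `[0, 1]`
  have hr : 0 ≤ ((m : ℝ) + 1) / ((m : ℝ) + 2) ∧ ((m : ℝ) + 1) / ((m : ℝ) + 2) ≤ 1 :=
    ⟨by positivity, by rw [div_le_one (by positivity)]; linarith⟩
  have hf1 : 1 - ((m : ℝ) + 1) / ((m : ℝ) + 2) * y * (2 - y) ≤ 1 := by
    nlinarith [mul_nonneg (mul_nonneg hr.1 hy0) (by linarith : (0:ℝ) ≤ 2 - y)]
  have hf2 : 1 - ((m : ℝ) + 1) / ((m : ℝ) + 2) * y * (1 - y) ≤ 1 := by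
    nlinarith [mul_nonneg (mul_nonneg hr.1 hy0) (by linarith : (0:ℝ) ≤ 1 - y)]
  have hA1 : 0 ≤ 2 - y - 2 / ((m : ℝ) + 1) := by
    rw [sub_nonneg, div_le_iff₀ (by positivity)]; nlinarith
  have hA2 : 0 ≤ 2 - y - 1 / ((m : ℝ) + 1) := by
    rw [sub_nonneg, div_le_iff₀ (by positivity)]; nlinarith
  have hP1 : 0 ≤ (m : ℝ) * (2 - y - 2 / ((m : ℝ) + 1)) ^ (m + 1) := by positivity
  have hP2 : 0 ≤ 2 * (2 - y - 1 / ((m : ℝ) + 1)) ^ (m + 1) := by positivity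
  -- drop the factors
  have hdrop : y ^ m * ((m : ℝ) * (2 - y - 2 / ((m : ℝ) + 1)) ^ (m + 1) * (1 - ((m : ℝ) + 1) / ((m : ℝ) + 2) * y * (2 - y)) +
      2 * (2 - y - 1 / ((m : ℝ) + 1)) ^ (m + 1) * (1 - ((m : ℝ) + 1) / ((m : ℝ) + 2) * y * (1 - y))) ≤
      y ^ m * ((m : ℝ) * (2 - y - 2 / ((m : ℝ) + 1)) ^ (m + 1) + 2 * (2 - y - 1 / ((m : ℝ) + 1)) ^ (m + 1)) := by
    refine mul_le_mul_of_nonneg_left ?_ (pow_nonneg hy0 m)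
    nlinarith [mul_le_mul_of_nonneg_left hf1 hP1, mul_le_mul_of_nonneg_left hf2 hP2]
  refine hdrop.trans ?_
  -- move `y` to the endpoint `1/2`
  have hm1 : (0 : ℝ) < (m : ℝ) + 1 := by positivity
  have hE1 := pow_mul_pow_le_endpoint m (m + 1) (2 - 2 / ((m : ℝ) + 1)) y (1 / 2) hy0 hy (by norm_num)
    (by
      have h : 2 / ((m : ℝ) + 1) ≤ 1 / 2 := by rw [div_le_iff₀ hm1]; linarith
      linarith)
    (by
      push_cast
      rw [show (m : ℝ) * (2 - 2 / ((m : ℝ) + 1) - 1 / 2) =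
        ((m : ℝ) + 1) * (1 / 2) + (2 * (m : ℝ) ^ 2 - 3 * m - 1) / (2 * ((m : ℝ) + 1)) by field_simp; ring]
      have h : 0 ≤ (2 * (m : ℝ) ^ 2 - 3 * m - 1) / (2 * ((m : ℝ) + 1)) := div_nonneg (by nlinarith) (by positivity)
      linarith)
  have hE2 := pow_mul_pow_le_endpoint m (m + 1) (2 - 1 / ((m : ℝ) + 1)) y (1 / 2) hy0 hy (by norm_num)
    (by
      have h : 1 / ((m : ℝ) + 1) ≤ 1 / 2 := by rw [div_le_iff₀ hm1]; linarith
      linarith)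
    (by
      push_cast
      rw [show (m : ℝ) * (2 - 1 / ((m : ℝ) + 1) - 1 / 2) =
        ((m : ℝ) + 1) * (1 / 2) + (2 * (m : ℝ) ^ 2 - m - 1) / (2 * ((m : ℝ) + 1)) by field_simp; ring]
      have h : 0 ≤ (2 * (m : ℝ) ^ 2 - m - 1) / (2 * ((m : ℝ) + 1)) := div_nonneg (by nlinarith) (by positivity)
      linarith)
  have e1 : ∀ t : ℝ, 2 - t - 2 / ((m : ℝ) + 1) = (2 - 2 / ((m : ℝ) + 1)) - t := fun t => by ring
  have e2 : ∀ t : ℝ, 2 - t - 1 / ((m : ℝ) + 1) = (2 - 1 / ((m : ℝ) + 1)) - t := fun t => by ring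
  have hhalf := bHalf_le_one m h3
  have e3 : (3 / 2 : ℝ) - 2 / ((m : ℝ) + 1) = (2 - 2 / ((m : ℝ) + 1)) - 1 / 2 := by ring
  have e4 : (3 / 2 : ℝ) - 1 / ((m : ℝ) + 1) = (2 - 1 / ((m : ℝ) + 1)) - 1 / 2 := by ring
  rw [e3, e4] at hhalf
  rw [e1 y, e2 y]
  have hm0' : (0 : ℝ) ≤ m := by linarith
  calc y ^ m * ((m : ℝ) * ((2 - 2 / ((m : ℝ) + 1)) - y) ^ (m + 1) + 2 * ((2 - 1 / ((m : ℝ) + 1)) - y) ^ (m + 1))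
      = (m : ℝ) * (y ^ m * ((2 - 2 / ((m : ℝ) + 1)) - y) ^ (m + 1)) + 2 * (y ^ m * ((2 - 1 / ((m : ℝ) + 1)) - y) ^ (m + 1)) := by
        ring
    _ ≤ (m : ℝ) * ((1 / 2) ^ m * ((2 - 2 / ((m : ℝ) + 1)) - 1 / 2) ^ (m + 1)) +
        2 * ((1 / 2) ^ m * ((2 - 1 / ((m : ℝ) + 1)) - 1 / 2) ^ (m + 1)) := by
        nlinarith [mul_le_mul_of_nonneg_left hE1 hm0']
    _ = (1 / 2 : ℝ) ^ m * ((m : ℝ) * ((2 - 2 / ((m : ℝ) + 1)) - 1 / 2) ^ (m + 1) + 2 * ((2 - 1 / ((m : ℝ) + 1)) - 1 / 2) ^ (m + 1)) := by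
        ring
    _ ≤ 1 := hhalf

end IndepBlob

end Quant

end Summit.CriticalPhenomena.PercolationContinuityZ3.Theorems
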